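import Summits.ResolutionOfSingularities.ResolutionOfSingularities.Theorems.WeightedInvariantIota3JSigmaDominanceUpgrade
import Summits.ResolutionOfSingularities.ResolutionOfSingularities.Theorems.WeightedInvariantIota3TwoFlagCompletion
import Summits.ResolutionOfSingularities.ResolutionOfSingularities.Theorems.WeightedInvariantJOpenPresentationCrossing
import Literature.AlgebraicGeometry.Resolution.WeightedInitialForms
import HarnessLib

/-!
# (o70-b) PART 2c — DOMINANCE OF THE SECOND MEMBER SUFFICES (weighted quasi-regularity, dim 3)
# (door `HypersurfaceCentreConstruction`, stmt-ResolutionOfSingularities-19897; clause h8 ⟸ (σ-pres)₃ ⟸ (o70-a) + (o70-b) + (o70-x);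
# SPEC (Δ12) rev 2 `L/res-L1-w43-plan-1/JSigmaCanon_sketch.lean` aceffaa8e08fb006 of res-L1-w43-plan-1; hand res-D-brk-1)

Topic: `Summits/ResolutionOfSingularities/ResolutionOfSingularities/Theorems`. Helper for the door item
`HypersurfaceCentreConstruction` (stmt-ResolutionOfSingularities-19897, route `WeightedInvariant`), line `local-engine`
(L W4.3), def-free.  After PART 1 (`r₂ = q`, p564416) and PART 2a (one-sided ⇒ mutual, p565670), (J-can) at `q < r₂` is the
statement that ONE σ-maximiser `(g₁', g₂')` sits in the filtration `F` of the other: `g₁' ∈ F(r₁) ∧ g₂' ∈ F(r₂)`.  Here, in a regular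
local ring of dimension `3` and for `r₂ < r₁`, the FIRST membership follows from the SECOND, from reaching alone:

* `mul_pow_not_mem_weightedIdealW` — the weighted order of a regular system `(c; w)` is a VALUATION on powers: `g ∈ F_a ∖ F_{a+1}`,
  `u` a unit ⇒ `u·g^k ∉ F_{ka+1}` (`inForm_mul`, `inForm_smul`, `inForm_eq_zero_iff` of the Literature: `gr_F S = κ[X,V,Y]` is a domain);
* `rest₂_le_pow_succ`, `rest₂_le_flagContactFiltration`, `flagContactFiltration_le_span_pow_sup_rest₂` — level `r₁ν` of a two-flag
  filtration with general second weight splits as `(g₁^ν) ⊔ REST`, `REST ≤ 𝔪^{ν+1}` (`r₂ < r₁`), and `REST' ≤ F(νa+1)` as soon as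
  `g₁' ∈ F(a)`, `g₂' ∈ F(r₂)`, `1 ≤ a < r₁`;
* `mem_weight₁_of_mem_weight₂` — **(E1)**: `f ∉ 𝔪^{ν+1}` in level `r₁ν` of the filtrations of the two-flag `(g₁, g₂)` and of
  `(g₁', g₂')`, `q ≤ r₂ < r₁`, and `g₂' ∈ F(r₂)` ⇒ `g₁' ∈ F(r₁)`: otherwise `a := max {n | g₁' ∈ F(n)} < r₁`, `f = c·g₁'^ν + m'`
  with `c` a unit and `m' ∈ F(νa+1)`, so `c·g₁'^ν ∈ F(νa+1)` against the valuation property;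
* `IsSigmaMaximiser.mem_weight₁_of_mem_weight₂` — the σ-maximiser wording (the completing `x` by (o70-x),
  `exists_span_triple_of_isTwoFlag`, p-landed by res-D-pv-048).

So the residue `hdom₊` of PART 2b is, for `r₂ < r₁`, the single membership `g₂' ∈ F(r₂) = (g₁, g₂) + 𝔪^⌈r₂/q⌉`.

[OURS · L1 W4.3 · (o70-b) PART 2c]  Replaces the role of NO printed item; NOT a statement of the manuscript
[claim: Hironaka2017, status: under-review]. AI work, weaker than expert review.  No named facts.

## References

* V. Cossart, U. Jannsen, S. Saito, LNM 2270 (2020), Def. 8.2, Lemma 8.3 (weighted initial forms). [CossartJannsenSaito2020]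
* H. Hironaka, J. Math. Kyoto Univ. 7 (1967), §1. [Hironaka1967]
-/

noncomputable section

set_option linter.dupNamespace false -- mandated namespace `Summit.<Summit>.<Problem>` of this single-conjunct summit

open IsLocalRing Literature.AlgebraicGeometry.Resolution
open Summit.ResolutionOfSingularities.ResolutionOfSingularities.Theorems

namespace Summit.ResolutionOfSingularities.ResolutionOfSingularities.Cruxes.HypersurfaceCentreConstruction.LocalEngine

namespace Iota3

universe u

/-! ## §0 Exponent bookkeeping for a general second weight -/

/-- `REST ≤ 𝔪^{ν+1}` bookkeeping for `q ≤ r₂ < r₁`: `(α, β) ≠ (ν, 0)`, `r₁ν − r₁α − r₂β ≤ q·e` ⇒ `ν + 1 ≤ α + β + e`. [folklore] -/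
theorem succ_le_of_ne_top_piece₂ {q r₁ r₂ ν α β e : ℕ} (hq : 0 < q) (hq₂ : q ≤ r₂) (hr : r₂ < r₁) (hne : ¬ (α = ν ∧ β = 0))
    (he : r₁ * ν - r₁ * α - r₂ * β ≤ q * e) : ν + 1 ≤ α + β + e := by
  rcases Nat.lt_or_ge ν α with h | h
  · omega
  rcases Nat.lt_or_ge α ν with h' | h'
  · obtain ⟨d, rfl⟩ : ∃ d, ν = α + (d + 1) := ⟨ν - α - 1, by omega⟩
    rw [Nat.mul_add, Nat.add_sub_cancel_left] at he
    rcases Nat.lt_or_ge (r₂ * β) (r₁ * (d + 1)) with hlt | hge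
    · -- `q(α+β+e) ≥ qα + r₁(d+1) − (r₂ − q)β > qν`
      have h1 : r₂ * ((r₂ - q) * β) < r₂ * ((r₁ - q) * (d + 1)) := by
        have e1 : r₂ * ((r₂ - q) * β) = (r₂ - q) * (r₂ * β) := by ring
        have e2 : (r₂ - q) * (r₁ * (d + 1)) + q * ((r₁ - r₂) * (d + 1)) = r₂ * ((r₁ - q) * (d + 1)) := by
          zify [hq₂, hr.le, (hq₂.trans hr.le)]
          ring
        have e3 : (r₂ - q) * (r₂ * β) ≤ (r₂ - q) * (r₁ * (d + 1)) := Nat.mul_le_mul_left _ hlt.le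
        rcases Nat.eq_zero_or_pos (r₂ - q) with h0 | hpos
        · rw [e1, h0, zero_mul, ← e2, h0, zero_mul, zero_add]
          exact Nat.mul_pos hq (Nat.mul_pos (by omega) (Nat.succ_pos d))
        · have e4 : (r₂ - q) * (r₂ * β) < (r₂ - q) * (r₁ * (d + 1)) := Nat.mul_lt_mul_of_pos_left hlt hpos
          rw [e1, ← e2]
          omega
      have h2 := Nat.lt_of_mul_lt_mul_left h1
      have h3 : (r₂ - q) * β + q * β = r₂ * β := by
        zify [hq₂]; ring
      have h4 : (r₁ - q) * (d + 1) + q * (d + 1) = r₁ * (d + 1) := by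
        zify [hq₂.trans hr.le]; ring
      have h5 : q * (d + 1) < q * (β + e) := by have := Nat.mul_add q β e; omega
      have := Nat.lt_of_mul_lt_mul_left h5
      omega
    · -- `r₂β ≥ r₁(d+1) > r₂(d+1)` ⇒ `β ≥ d + 2`
      have h1 : r₂ * (d + 1) < r₂ * β := lt_of_lt_of_le (Nat.mul_lt_mul_of_pos_right hr (Nat.succ_pos d)) hge
      have := Nat.lt_of_mul_lt_mul_left h1
      omega
  · have : α = ν := le_antisymm h h'
    omega

/-- `REST' ≤ F(νa+1)` bookkeeping: `1 ≤ a`, `a + 1 ≤ r₁`, `1 ≤ r₂`, `(α, β) ≠ (ν, 0)`, `r₁ν − r₁α − r₂β ≤ q·e` ⇒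
`νa + 1 ≤ αa + βr₂ + q·e`. [folklore] -/
theorem succ_le_weight_of_ne_top_piece {q r₁ r₂ ν α β e a : ℕ} (ha : 1 ≤ a) (har : a + 1 ≤ r₁) (hr₂ : 1 ≤ r₂)
    (hne : ¬ (α = ν ∧ β = 0)) (he : r₁ * ν - r₁ * α - r₂ * β ≤ q * e) : ν * a + 1 ≤ α * a + β * r₂ + q * e := by
  rcases Nat.lt_or_ge ν α with h | h
  · have h1 : (ν + 1) * a ≤ α * a := Nat.mul_le_mul_right a h
    have h2 : (ν + 1) * a = ν * a + a := by ring
    omega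
  rcases Nat.lt_or_ge α ν with h' | h'
  · obtain ⟨d, rfl⟩ : ∃ d, ν = α + (d + 1) := ⟨ν - α - 1, by omega⟩
    rw [Nat.mul_add, Nat.add_sub_cancel_left] at he
    have h3 : (α + (d + 1)) * a = α * a + a * (d + 1) := by ring
    have h4 : (a + 1) * (d + 1) ≤ r₁ * (d + 1) := Nat.mul_le_mul_right _ har
    have h5 : (a + 1) * (d + 1) = a * (d + 1) + (d + 1) := by ring
    rcases Nat.lt_or_ge (r₂ * β) (r₁ * (d + 1)) with hlt | hge
    · have h6 : β * r₂ = r₂ * β := mul_comm _ _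
      omega
    · have h6 : β * r₂ = r₂ * β := mul_comm _ _
      omega
  · have : α = ν := le_antisymm h h'
    subst this
    have : 1 ≤ β := by omega
    have h1 : r₂ ≤ β * r₂ := Nat.le_mul_of_pos_left r₂ this
    omega

/-! ## §1 Splitting level `r₁ν` (general second weight; any local ring) -/

section LocalRing

variable {S : Type u} [CommRing S] [IsLocalRing S]

/-- `F(r₁ν) ≤ (g₁^ν) ⊔ REST`, `REST = ⨆_{(α,β) ≠ (ν,0)} (g₁^α g₂^β)·𝔪^⌈(r₁ν − r₁α − r₂β)/q⌉`. [folklore] -/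
theorem flagContactFiltration_le_span_pow_sup_rest₂ (g₁ g₂ : S) (q r₁ r₂ ν : ℕ) :
    flagContactFiltration g₁ g₂ q r₁ r₂ (r₁ * ν) ≤ Ideal.span {g₁ ^ ν} ⊔
      ⨆ α : ℕ, ⨆ β : ℕ, ⨆ (_ : ¬ (α = ν ∧ β = 0)),
        Ideal.span {g₁ ^ α * g₂ ^ β} * maximalIdeal S ^ ((r₁ * ν - r₁ * α - r₂ * β + q - 1) / q) := by
  rw [flagContactFiltration_def]
  refine iSup_le fun α => iSup_le fun β => ?_
  by_cases h : α = ν ∧ β = 0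
  · obtain ⟨rfl, rfl⟩ := h
    refine le_sup_of_le_left ((Ideal.mul_le_right).trans ?_)
    rw [pow_zero, mul_one]
  · exact le_sup_of_le_right (le_iSup_of_le α (le_iSup_of_le β (le_iSup_of_le h le_rfl)))

/-- `REST ≤ 𝔪^{ν+1}` for `q ≤ r₂ < r₁`. [folklore] -/
theorem rest₂_le_pow_succ {g₁ g₂ : S} (hg₁ : g₁ ∈ maximalIdeal S) (hg₂ : g₂ ∈ maximalIdeal S) {q r₁ r₂ : ℕ}
    (hq : 0 < q) (hq₂ : q ≤ r₂) (hr : r₂ < r₁) (ν : ℕ) :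
    (⨆ α : ℕ, ⨆ β : ℕ, ⨆ (_ : ¬ (α = ν ∧ β = 0)),
        Ideal.span {g₁ ^ α * g₂ ^ β} * maximalIdeal S ^ ((r₁ * ν - r₁ * α - r₂ * β + q - 1) / q)) ≤
      maximalIdeal S ^ (ν + 1) := by
  refine iSup_le fun α => iSup_le fun β => iSup_le fun hne => ?_
  set e := (r₁ * ν - r₁ * α - r₂ * β + q - 1) / q with he
  have hE : ν + 1 ≤ α + β + e :=
    succ_le_of_ne_top_piece₂ hq hq₂ hr hne (by simpa [he] using le_add_mul_cdiv hq (r₁ * ν - r₁ * α - r₂ * β) 0)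
  exact (flagPiece_le_pow hg₁ hg₂ α β e).trans (Ideal.pow_le_pow_right hE)

/-- `REST' ≤ F(νa+1)` when `g₁' ∈ F(a)`, `g₂' ∈ F(r₂)`, `1 ≤ a`, `a + 1 ≤ r₁` (`F` the filtration of another pair `(g₁, g₂)` with the
same weights). [folklore] -/
theorem rest₂_le_flagContactFiltration {g₁ g₂ g₁' g₂' : S} {q r₁ r₂ a : ℕ} (hq : 0 < q) (hq₂ : q ≤ r₂) (ha : 1 ≤ a)
    (har : a + 1 ≤ r₁) (h₁ : g₁' ∈ flagContactFiltration g₁ g₂ q r₁ r₂ a) (h₂ : g₂' ∈ flagContactFiltration g₁ g₂ q r₁ r₂ r₂)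
    (ν : ℕ) :
    (⨆ α : ℕ, ⨆ β : ℕ, ⨆ (_ : ¬ (α = ν ∧ β = 0)),
        Ideal.span {g₁' ^ α * g₂' ^ β} * maximalIdeal S ^ ((r₁ * ν - r₁ * α - r₂ * β + q - 1) / q)) ≤
      flagContactFiltration g₁ g₂ q r₁ r₂ (ν * a + 1) := by
  refine iSup_le fun α => iSup_le fun β => iSup_le fun hne => ?_
  set e := (r₁ * ν - r₁ * α - r₂ * β + q - 1) / q with he
  have hE : ν * a + 1 ≤ α * a + β * r₂ + q * e :=
    succ_le_weight_of_ne_top_piece ha har (hq.le.trans hq₂ |> fun h => Nat.succ_le_of_lt (lt_of_lt_of_le hq hq₂)) hne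
      (by simpa [he] using le_add_mul_cdiv hq (r₁ * ν - r₁ * α - r₂ * β) 0)
  have hA : Ideal.span {g₁' ^ α * g₂' ^ β} ≤ flagContactFiltration g₁ g₂ q r₁ r₂ (a * α + r₂ * β) := by
    rw [Ideal.span_singleton_le_iff_mem]
    have hα : g₁' ^ α ∈ flagContactFiltration g₁ g₂ q r₁ r₂ (a * α) :=
      pow_le_flagContactFiltration_mul g₁ g₂ r₁ r₂ hq a α (Ideal.pow_mem_pow h₁ α)
    have hβ : g₂' ^ β ∈ flagContactFiltration g₁ g₂ q r₁ r₂ (r₂ * β) :=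
      pow_le_flagContactFiltration_mul g₁ g₂ r₁ r₂ hq r₂ β (Ideal.pow_mem_pow h₂ β)
    exact flagContactFiltration_mul_le g₁ g₂ q r₁ r₂ hq _ _ (Ideal.mul_mem_mul hα hβ)
  have hB : maximalIdeal S ^ e ≤ flagContactFiltration g₁ g₂ q r₁ r₂ (q * e) :=
    (Ideal.pow_right_mono (maximalIdeal_le_flagContactFiltration g₁ g₂ r₁ r₂ hq) e).trans
      (pow_le_flagContactFiltration_mul g₁ g₂ r₁ r₂ hq q e)
  refine (Ideal.mul_mono hA hB).trans ((flagContactFiltration_mul_le g₁ g₂ q r₁ r₂ hq _ _).trans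
    (flagContactFiltration_antitone g₁ g₂ q r₁ r₂ ?_))
  have : a * α + r₂ * β = α * a + β * r₂ := by ring
  omega

end LocalRing

/-! ## §2 The weighted order is a valuation on powers (regular, dimension 3) -/

section Valuation

variable {R : Type u} [CommRing R] [IsRegularLocalRing R]

/-- **`u · g^k ∉ F_{ka+1}` for `g ∈ F_a ∖ F_{a+1}`, `u` a unit, `1 ≤ k`** (regular local, `dim = 3`, `(c) = 𝔪`, positive weights):
the graded ring of the weighted filtration is the weighted polynomial ring over the residue field, a domain
(`inForm_mul`, `inForm_smul`, `inForm_eq_zero_iff`). [cite: CossartJannsenSaito2020, Lemma 8.3] -/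
theorem mul_pow_not_mem_weightedIdealW (c : Fin 3 → R) (hgen : Ideal.span {c 0, c 1, c 2} = maximalIdeal R)
    (hdim : ringKrullDim R = 3) {w : Fin 3 → ℕ} (hw : ∀ i, 0 < w i) {g : R} {a : ℕ} (hg : g ∈ weightedIdealW c w a)
    (hg' : g ∉ weightedIdealW c w (a + 1)) {u : R} (hu : IsUnit u) {k : ℕ} (hk : 1 ≤ k) :
    u * g ^ k ∉ weightedIdealW c w (k * a + 1) := by
  -- `g^k ∈ F_{ka}` with nonzero initial form
  have key : ∀ j, 1 ≤ j → g ^ j ∈ weightedIdealW c w (j * a) ∧ inForm c w (j * a) (g ^ j) ≠ 0 := by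
    intro j hj
    induction j, hj using Nat.le_induction with
    | base =>
      rw [pow_one, one_mul]
      exact ⟨hg, fun h0 => hg' ((inForm_eq_zero_iff c hgen hdim hw hg).mp h0)⟩
    | succ j hj ih =>
      obtain ⟨hmem, hne⟩ := ih
      have hmem' : g ^ (j + 1) ∈ weightedIdealW c w ((j + 1) * a) := by
        rw [pow_succ, Nat.succ_mul]
        exact weightedIdealW_mul_le c w _ _ (Ideal.mul_mem_mul hmem hg)
      refine ⟨hmem', ?_⟩
      rw [pow_succ, Nat.succ_mul, inForm_mul c hgen hdim hw hmem hg]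
      exact mul_ne_zero hne fun h0 => hg' ((inForm_eq_zero_iff c hgen hdim hw hg).mp h0)
  obtain ⟨hmem, hne⟩ := key k hk
  have hmem' : u * g ^ k ∈ weightedIdealW c w (k * a) := Ideal.mul_mem_left _ u hmem
  intro hbad
  have h0 : inForm c w (k * a) (u * g ^ k) = 0 := (inForm_eq_zero_iff c hgen hdim hw hmem').mpr hbad
  rw [inForm_smul c hgen hdim hw hmem u] at h0
  rcases mul_eq_zero.mp h0 with h | h
  · exact (hu.map (residue R)).ne_zero (MvPolynomial.C_eq_zero.mp h)
  · exact hne h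

end Valuation

/-! ## §3 (E1): the second membership gives the first -/

section SecondMember

variable {S : Type} [CommRing S] [IsRegularLocalRing S]

/-- **(E1).** In a regular local ring of dimension `3` with `𝔪 = (x, g₂, g₁)`: if `f ∉ 𝔪^{ν+1}` (`0 < ν`) lies in level `r₁ν` of the
`(q; r₁, r₂)`-filtrations of `(g₁, g₂)` and of `g₁', g₂' ∈ 𝔪`, with `0 < q ≤ r₂ < r₁`, and the second member satisfies
`g₂' ∈ F_{(g₁,g₂)}(r₂)`, then also `g₁' ∈ F_{(g₁,g₂)}(r₁)`.  No maximality is used. [OURS · L1 W4.3 · (o70-b)] -/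
theorem mem_weight₁_of_mem_weight₂ (hdim : ringKrullDim S = 3) {x g₁ g₂ g₁' g₂' f : S} {q r₁ r₂ ν : ℕ}
    (h𝔪 : Ideal.span {x, g₂, g₁} = maximalIdeal S) (hq : 0 < q) (hq₂ : q ≤ r₂) (hr : r₂ < r₁) (hν : 0 < ν)
    (hf : f ∉ maximalIdeal S ^ (ν + 1)) (hF : f ∈ flagContactFiltration g₁ g₂ q r₁ r₂ (r₁ * ν))
    (hg₁' : g₁' ∈ maximalIdeal S) (hg₂' : g₂' ∈ maximalIdeal S) (hF' : f ∈ flagContactFiltration g₁' g₂' q r₁ r₂ (r₁ * ν))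
    (h₂ : g₂' ∈ flagContactFiltration g₁ g₂ q r₁ r₂ r₂) : g₁' ∈ flagContactFiltration g₁ g₂ q r₁ r₂ r₁ := by
  classical
  by_contra h₁
  -- `a := max {n ≤ r₁ | g₁' ∈ F(n)}`
  set P : ℕ → Prop := fun n => g₁' ∈ flagContactFiltration g₁ g₂ q r₁ r₂ n with hP
  set a := Nat.findGreatest P r₁ with ha
  have hq₁ : q ≤ r₁ := hq₂.trans hr.le
  have hPq : P q := maximalIdeal_le_flagContactFiltration g₁ g₂ r₁ r₂ hq hg₁'
  have hPa : g₁' ∈ flagContactFiltration g₁ g₂ q r₁ r₂ a := Nat.findGreatest_spec (P := P) hq₁ hPq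
  have hqa : q ≤ a := Nat.le_findGreatest hq₁ hPq
  have har₁ : a ≤ r₁ := Nat.findGreatest_le r₁
  have hane : a ≠ r₁ := fun h => h₁ (by rw [h] at hPa; exact hPa)
  have har : a + 1 ≤ r₁ := by omega
  have hnot : g₁' ∉ flagContactFiltration g₁ g₂ q r₁ r₂ (a + 1) :=
    Nat.findGreatest_is_greatest (P := P) (Nat.lt_succ_self a) har
  have ha1 : 1 ≤ a := hq.trans_le hqa |> Nat.succ_le_of_lt
  -- `f = c · g₁'^ν + m'`, `c` a unit, `m' ∈ F(νa+1)`
  obtain ⟨t, ht, m', hm', hsum⟩ := Submodule.mem_sup.mp (flagContactFiltration_le_span_pow_sup_rest₂ g₁' g₂' q r₁ r₂ ν hF')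
  obtain ⟨c, rfl⟩ := Ideal.mem_span_singleton'.mp ht
  have hc : IsUnit c := by
    by_contra hcu
    refine hf ?_
    rw [← hsum]
    refine Ideal.add_mem _ ?_ (rest₂_le_pow_succ hg₁' hg₂' hq hq₂ hr ν hm')
    rw [pow_succ']
    exact Ideal.mul_mem_mul ((IsLocalRing.mem_maximalIdeal c).mpr hcu) (Ideal.pow_mem_pow hg₁' ν)
  have hm'F : m' ∈ flagContactFiltration g₁ g₂ q r₁ r₂ (ν * a + 1) :=
    rest₂_le_flagContactFiltration hq hq₂ ha1 har hPa h₂ ν hm'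
  have hfF : f ∈ flagContactFiltration g₁ g₂ q r₁ r₂ (ν * a + 1) := by
    refine flagContactFiltration_antitone g₁ g₂ q r₁ r₂ ?_ hF
    have := Nat.mul_le_mul_left ν har
    rw [Nat.mul_add, mul_one] at this
    have hν' : ν * a + 1 ≤ ν * a + ν := by omega
    rw [mul_comm r₁]
    exact hν'.trans this
  have hcg : c * g₁' ^ ν ∈ flagContactFiltration g₁ g₂ q r₁ r₂ (ν * a + 1) := by
    have : c * g₁' ^ ν = f - m' := by rw [← hsum]; ring
    rw [this]
    exact Ideal.sub_mem _ hfF hm'F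
  -- the weighted order of `(x, g₂, g₁; q, r₂, r₁)` is a valuation on powers
  have hw : ∀ i, 0 < (![q, r₂, r₁] : Fin 3 → ℕ) i := by
    intro i
    fin_cases i
    · exact hq
    · exact lt_of_lt_of_le hq hq₂
    · exact lt_of_lt_of_le hq hq₁
  have hgen : Ideal.span {(![x, g₂, g₁] : Fin 3 → S) 0, (![x, g₂, g₁] : Fin 3 → S) 1, (![x, g₂, g₁] : Fin 3 → S) 2} =
      maximalIdeal S := by
    simpa using h𝔪
  have hbridge : ∀ n, flagContactFiltration g₁ g₂ q r₁ r₂ n = weightedIdealW ![x, g₂, g₁] ![q, r₂, r₁] n := fun n => by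
    rw [flagContactFiltration_eq_weightedMonomialIdeal h𝔪 hq hq₂ hq₁ n, CrossingPoint.weightedMonomialIdeal_eq_weightedIdealW]
  have hga : g₁' ∈ weightedIdealW ![x, g₂, g₁] ![q, r₂, r₁] a := by rw [← hbridge]; exact hPa
  have hga' : g₁' ∉ weightedIdealW ![x, g₂, g₁] ![q, r₂, r₁] (a + 1) := by rw [← hbridge]; exact hnot
  have := mul_pow_not_mem_weightedIdealW ![x, g₂, g₁] hgen hdim hw hga hga' hc hν
  rw [← hbridge] at this
  exact this hcg

/-- **(E1) for σ-maximisers** (regular local of dimension `3`; the completing `x` by (o70-x) `exists_span_triple_of_isTwoFlag`):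
two σ-maximisers of `f` (`f ∉ 𝔪^{ν+1}`, `0 < ν`) with the same triple, `r₂ < r₁`: if the second member of the second lies in
level `r₂` of the first, so does the first member in level `r₁` — hence (PART 2a) the two filtrations are EQUAL.
[OURS · L1 W4.3 · (o70-b)] -/
theorem IsSigmaMaximiser.flagContactFiltration_eq_of_mem_weight₂ (hdim : ringKrullDim S = (3 : ℕ)) {f : S} {ν : ℕ}
    {g₁ g₂ g₁' g₂' : S} {q r₁ r₂ : ℕ} (hν : 0 < ν) (hf : f ∉ maximalIdeal S ^ (ν + 1))
    (h : IsSigmaMaximiser f ν g₁ g₂ q r₁ r₂) (h' : IsSigmaMaximiser f ν g₁' g₂' q r₁ r₂) (hr : r₂ < r₁)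
    (h₂ : g₂' ∈ flagContactFiltration g₁ g₂ q r₁ r₂ r₂) (n : ℕ) :
    flagContactFiltration g₁' g₂' q r₁ r₂ n = flagContactFiltration g₁ g₂ q r₁ r₂ n := by
  obtain ⟨x, hx, -⟩ := exists_span_triple_of_isTwoFlag S hdim g₁ g₂ h.2.1
  have hdim' : ringKrullDim S = 3 := by rw [hdim]; rfl
  have h₁ : g₁' ∈ flagContactFiltration g₁ g₂ q r₁ r₂ r₁ :=
    mem_weight₁_of_mem_weight₂ hdim' hx h.1.1 h.1.2.1 hr hν hf h.2.2.1 h'.2.1.1 h'.2.1.2.1 h'.2.2.1 h₂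
  exact (flagContactFiltration_eq_of_oneSided h'.2.1 h.1 h.2.1.1 h.2.1.2.1 h₁ h₂ n).symm

end SecondMember

end Iota3

end Summit.ResolutionOfSingularities.ResolutionOfSingularities.Cruxes.HypersurfaceCentreConstruction.LocalEngine

end
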